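import Literature.MathematicalPhysics.QuantumFieldTheory.BalabanImbrieJaffe1984to88.BIJ88Sect5StatementsPart3
import Literature.MathematicalPhysics.QuantumFieldTheory.BalabanImbrieJaffe1984to88.BIJ88Sect5StatementsPart2

/-!
# `BalabanImbrieJaffe1984to88.BIJ88Ineq594Proof` — T. Bałaban, J. Imbrie, A. Jaffe, *Effective action and cluster
properties of the abelian Higgs model*, Commun. Math. Phys. **114** (1988) 257–315 [BalabanImbrieJaffe1988]:
**(5.9.4)** p. 297 PROVED — *"We remarked earlier that A′ is small in Λ₁^{(k)*}. We then defined A^{(k)} = A′ +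
Λ₄^{(k)*}L^{−2}C^{(k)}_{loc}H*_{k,loc}∂*Q^{e*}_{k+1}f. Since f is small and H_{k,loc} is regular, we have that |A_b^{(k)}| ≤ cp(e_k), b ∈ Λ₁^{(k)*}.
(5.9.4)"* — for the field `A^{(k)}` defined through the CONCRETE translation (5.5.2) `BIJ88Sect5StatementsPart3.transl552` (r16,
p243601) over the function space `ι → ℝ` (kind «model-instance» for the typed leaf `BIJ88Sect5StatementsPart2.Ineq594`).

statement-level skeleton of published theorems with citation tags; proofs where landed; nothing here is a claim about the Yang–Mills mass gap

PDF held: `paper:balaban1988-cmp114-bij-abelian-higgs-effective-action` (journal page = PDF page + 256).  Page read as image: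
PDF p. 41 (journal 297), `g4png.py` ×2 render `HOME/lit-balaban-r16/renders/cmp114/original-p041-x2.png`.

CITATION HEADER (lean-in-tree rule).  Part of the lit-balaban TYPED SKELETON (HOME `run/shared/lean/pub/lit-balaban/`), Phase 2,
seat p36 (gen 3, unit `lit-balaban-p36`); row **C2.Eq5.9.4-5.9.5**, display (5.9.4), of `HOME/lit-balaban-r16/ROWS-C2-part2.md` (leaf
typed p240155 by r16).  WHAT IS REPRODUCED, and how (theorem-only; the three printed inputs as the three displayed hypotheses):
*"A′ is small in Λ₁^{(k)*}"* = `|A′_b| ≤ c₁p(e_k)` on the region (p. 280, `BIJ88Sect5StatementsPart3.SmallAPrime` shape); *"f is small"*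
= the sup norm `‖f‖ ≤ c₂p(e_k)` ((5.9.1)); *"H_{k,loc} is regular"* = an `ℓ^∞ → ℓ^∞` bound `K₀` for the composite operator
`Λ₄^{(k)*}C^{(k)}_{loc}H*_{k,loc}∂*Q^{e*}_{k+1}` (real-linear endomorphisms of `ι → ℝ`, as in `transl552`).  Then `A^{(k)} := A′ +
L^{−2}Λ₄C_{loc}H*_{loc}(∂*Q^{e*}f)` inverts (5.5.2) (`transl552_fieldAk : transl552 L Λ4 Cloc Hsloc X A^{(k)} f = A′`) and
**`ineq594 : Ineq594 ι inRegion A^{(k)} (c₁ + L^{−2}K₀c₂) p(e_k)`** — the constant explicit.  KERNEL FORM `ineq594_kernels`: the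
operators as kernel operators `Matrix.mulVecLin` (Λ₄ = the diagonal 0/1-type multiplier `χ₄`, |χ₄| ≤ 1), *"regular"* = the printed
kernel decay **(2.5)** `BIJ88Sect2Statements.Decay dist K c` for `C^{(k)}_{loc}` ((2.26)/(2.41) type) and `H*_{k,loc}` ((2.5)), plus the
lattice sums `Σ_a e^{−c dist(b,a)} ≤ S` and a row-sum bound `R_X` for the bounded finite-range `∂*Q^{e*}_{k+1}`; then
`K₀ = (c_C S_C)(c_H S_H)R_X` (`rowsum_le_of_decay`, `abs_mulVec_le`: the `ℓ^∞ → ℓ^∞` norm of a kernel operator is at most its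
maximal row sum).  NOT here: (5.9.5) (which cites [8, Eq. (2.113)]); no new `Prop` facts; axioms standard.
-/

namespace Literature.MathematicalPhysics.QuantumFieldTheory.BalabanImbrieJaffe1984to88.BIJ88Ineq594Proof

open BIJ88Sect5StatementsPart2 BIJ88Sect5StatementsPart3

section Main

variable {ι : Type} [Fintype ι]

omit [Fintype ι] in
/-- **(5.9.4)**, the definition *"A^{(k)} = A′ + Λ₄^{(k)*}L^{−2}C^{(k)}_{loc}H*_{k,loc}∂*Q^{e*}_{k+1}f"* inverts the translation (5.5.2):
`transl552 L Λ4 Cloc Hsloc X (A′ + L^{−2}Λ₄C_{loc}H*_{loc}Xf) f = A′` (`X = ∂*Q^{e*}_{k+1}`). [cite: BalabanImbrieJaffe1988, (5.9.4) p.297] -/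
theorem transl552_fieldAk (L : ℝ) (Λ4 Cloc Hsloc X : Module.End ℝ (ι → ℝ)) (A' f : ι → ℝ) :
    transl552 L Λ4 Cloc Hsloc X (A' + L⁻¹ ^ 2 • Λ4 (Cloc (Hsloc (X f)))) f = A' := by
  unfold transl552
  abel

/-- **(5.9.4)** p. 297: *"Since f is small and H_{k,loc} is regular, we have that |A_b^{(k)}| ≤ cp(e_k), b ∈ Λ₁^{(k)*}"* — with
`A^{(k)} = A′ + L^{−2}Λ₄C_{loc}H*_{loc}(Xf)`: from `|A′_b| ≤ c₁p(e_k)` on the region, `‖f‖_∞ ≤ c₂p(e_k)` and the `ℓ^∞` bound `K₀` of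
`Λ₄C_{loc}H*_{loc}X`, `|A^{(k)}_b| ≤ (c₁ + L^{−2}K₀c₂)p(e_k)` on the region. [cite: BalabanImbrieJaffe1988, (5.9.4) p.297] -/
theorem ineq594 (L : ℝ) (Λ4 Cloc Hsloc X : Module.End ℝ (ι → ℝ)) (A' f : ι → ℝ) (inRegion : ι → Prop)
    {c₁ c₂ K₀ pek : ℝ} (hK₀ : 0 ≤ K₀)
    (hA' : ∀ b, inRegion b → |A' b| ≤ c₁ * pek) (hf : ‖f‖ ≤ c₂ * pek)
    (hK : ∀ g : ι → ℝ, ∀ b, |Λ4 (Cloc (Hsloc (X g))) b| ≤ K₀ * ‖g‖) :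
    Ineq594 ι inRegion (A' + L⁻¹ ^ 2 • Λ4 (Cloc (Hsloc (X f)))) (c₁ + L⁻¹ ^ 2 * K₀ * c₂) pek := by
  intro b hb
  rw [Pi.add_apply, Pi.smul_apply, smul_eq_mul]
  have h1 := hA' b hb
  have h2 : |L⁻¹ ^ 2 * Λ4 (Cloc (Hsloc (X f))) b| ≤ L⁻¹ ^ 2 * (K₀ * (c₂ * pek)) := by
    rw [abs_mul, abs_of_nonneg (sq_nonneg L⁻¹)]
    exact mul_le_mul_of_nonneg_left ((hK f b).trans (mul_le_mul_of_nonneg_left hf hK₀)) (sq_nonneg L⁻¹)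
  calc |A' b + L⁻¹ ^ 2 * Λ4 (Cloc (Hsloc (X f))) b| ≤ |A' b| + |L⁻¹ ^ 2 * Λ4 (Cloc (Hsloc (X f))) b| := abs_add_le _ _
    _ ≤ c₁ * pek + L⁻¹ ^ 2 * (K₀ * (c₂ * pek)) := add_le_add h1 h2
    _ = (c₁ + L⁻¹ ^ 2 * K₀ * c₂) * pek := by ring

/-- the same with `A^{(k)}` characterized through (5.5.2) rather than defined: ANY `A^{(k)}` with `transl552 L Λ4 Cloc Hsloc X A^{(k)} f = A′`
obeys (5.9.4). [cite: BalabanImbrieJaffe1988, (5.9.4) p.297] -/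
theorem ineq594_of_transl552 (L : ℝ) (Λ4 Cloc Hsloc X : Module.End ℝ (ι → ℝ)) (A' Ak f : ι → ℝ) (inRegion : ι → Prop)
    {c₁ c₂ K₀ pek : ℝ} (hK₀ : 0 ≤ K₀) (h552 : transl552 L Λ4 Cloc Hsloc X Ak f = A')
    (hA' : ∀ b, inRegion b → |A' b| ≤ c₁ * pek) (hf : ‖f‖ ≤ c₂ * pek)
    (hK : ∀ g : ι → ℝ, ∀ b, |Λ4 (Cloc (Hsloc (X g))) b| ≤ K₀ * ‖g‖) :
    Ineq594 ι inRegion Ak (c₁ + L⁻¹ ^ 2 * K₀ * c₂) pek := by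
  have hAk : Ak = A' + L⁻¹ ^ 2 • Λ4 (Cloc (Hsloc (X f))) := by
    rw [← h552]; unfold transl552; abel
  rw [hAk]
  exact ineq594 L Λ4 Cloc Hsloc X A' f inRegion hK₀ hA' hf hK

end Main

/-! ## "H_{k,loc} is regular": the `ℓ^∞` bound from the printed kernel decay (2.5) -/

section Kernels

variable {ι : Type} [Fintype ι]

/-- the `ℓ^∞ → ℓ^∞` bound of a kernel operator by its maximal row sum: `|(Mg)(b)| ≤ (Σ_a |M(b,a)|)‖g‖_∞ ≤ R‖g‖_∞`.
[cite: BalabanImbrieJaffe1988, (2.13) p.261] -/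
theorem abs_mulVec_le (M : Matrix ι ι ℝ) {R : ℝ} (hR : ∀ b, ∑ a, |M b a| ≤ R) (g : ι → ℝ) (b : ι) :
    |M.mulVec g b| ≤ R * ‖g‖ := by
  have hg : ∀ a, |g a| ≤ ‖g‖ := fun a => by rw [← Real.norm_eq_abs]; exact norm_le_pi_norm g a
  calc |M.mulVec g b| = |∑ a, M b a * g a| := rfl
    _ ≤ ∑ a, |M b a * g a| := Finset.abs_sum_le_sum_abs _ _
    _ = ∑ a, |M b a| * |g a| := by simp_rw [abs_mul]
    _ ≤ ∑ a, |M b a| * ‖g‖ := Finset.sum_le_sum fun a _ => mul_le_mul_of_nonneg_left (hg a) (abs_nonneg _)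
    _ = (∑ a, |M b a|) * ‖g‖ := by rw [Finset.sum_mul]
    _ ≤ R * ‖g‖ := mul_le_mul_of_nonneg_right (hR b) (norm_nonneg _)

/-- the same as a sup-norm bound `‖Mg‖_∞ ≤ R‖g‖_∞`. [cite: BalabanImbrieJaffe1988, (2.13) p.261] -/
theorem norm_mulVec_le (M : Matrix ι ι ℝ) {R : ℝ} (hR0 : 0 ≤ R) (hR : ∀ b, ∑ a, |M b a| ≤ R) (g : ι → ℝ) :
    ‖M.mulVec g‖ ≤ R * ‖g‖ := by
  refine (pi_norm_le_iff_of_nonneg (mul_nonneg hR0 (norm_nonneg g))).2 fun b => ?_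
  rw [Real.norm_eq_abs]
  exact abs_mulVec_le M hR g b

/-- *"H_{k,loc} is regular"* (p. 297) made quantitative: the printed kernel decay **(2.5)** p. 260 `|K(b,a)| ≤ ce^{−c dist(b,a)}`
(`BIJ88Sect2Statements.Decay`) and a lattice sum `Σ_a e^{−c dist(b,a)} ≤ S` bound every row sum by `cS`.
[cite: BalabanImbrieJaffe1988, (2.5) p.260] -/
theorem rowsum_le_of_decay {dist : ι → ι → ℝ} {K : ι → ι → ℝ} {c S : ℝ} (hc : 0 ≤ c)
    (hK : BIJ88Sect2Statements.Decay dist K c) (hS : ∀ b, ∑ a, Real.exp (-c * dist b a) ≤ S) (b : ι) :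
    ∑ a, |K b a| ≤ c * S := by
  calc ∑ a, |K b a| ≤ ∑ a, c * Real.exp (-c * dist b a) := Finset.sum_le_sum fun a _ => hK b a
    _ = c * ∑ a, Real.exp (-c * dist b a) := by rw [Finset.mul_sum]
    _ ≤ c * S := mul_le_mul_of_nonneg_left (hS b) hc

variable [DecidableEq ι]

/-- **(5.9.4)** p. 297 in KERNEL FORM: `A^{(k)} = A′ + L^{−2}Λ₄C_{loc}H*_{loc}(∂*Q^{e*}_{k+1}f)` with the operators as kernel operators
on `ι → ℝ` — `Λ₄` the multiplier by `χ₄` (`|χ₄| ≤ 1`, the restriction to `Λ₄^{(k)*}`), `C^{(k)}_{loc}` and `H*_{k,loc}` kernels with the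
printed exponential decay (2.5)/(2.41) `Decay dist · c` (*"H_{k,loc} is regular"*), `∂*Q^{e*}_{k+1}` any kernel with row sums `≤ R_X`
(bounded, finite range) — and the smallness inputs `|A′_b| ≤ c₁p(e_k)` on `Λ₁^{(k)*}` (p. 280), `‖f‖_∞ ≤ c₂p(e_k)` ((5.9.1), *"f is
small"*): then `|A^{(k)}_b| ≤ (c₁ + L^{−2}(c_C S_C)(c_H S_H)R_X c₂) p(e_k)` for `b ∈ Λ₁^{(k)*}`, i.e. `Ineq594` with that constant.
[cite: BalabanImbrieJaffe1988, (5.9.4) p.297] -/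
theorem ineq594_kernels (L : ℝ) (dist : ι → ι → ℝ) (χ₄ : ι → ℝ) (Cl Hs X : Matrix ι ι ℝ) (A' f : ι → ℝ)
    (inRegion : ι → Prop) {c₁ c₂ cC cH SC SH RX pek : ℝ} (hcC : 0 ≤ cC) (hcH : 0 ≤ cH) (hSC0 : 0 ≤ SC)
    (hSH0 : 0 ≤ SH) (hRX : 0 ≤ RX)
    (hA' : ∀ b, inRegion b → |A' b| ≤ c₁ * pek) (hf : ‖f‖ ≤ c₂ * pek) (hχ : ∀ b, |χ₄ b| ≤ 1)
    (hCl : BIJ88Sect2Statements.Decay dist Cl cC) (hSC : ∀ b, ∑ a, Real.exp (-cC * dist b a) ≤ SC)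
    (hHs : BIJ88Sect2Statements.Decay dist Hs cH) (hSH : ∀ b, ∑ a, Real.exp (-cH * dist b a) ≤ SH)
    (hX : ∀ b, ∑ a, |X b a| ≤ RX) :
    Ineq594 ι inRegion
      (A' + L⁻¹ ^ 2 • (Matrix.diagonal χ₄).mulVecLin (Cl.mulVecLin (Hs.mulVecLin (X.mulVecLin f))))
      (c₁ + L⁻¹ ^ 2 * (cC * SC * (cH * SH) * RX) * c₂) pek := by
  have hK : ∀ g : ι → ℝ, ∀ b,
      |(Matrix.diagonal χ₄).mulVecLin (Cl.mulVecLin (Hs.mulVecLin (X.mulVecLin g))) b|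
        ≤ cC * SC * (cH * SH) * RX * ‖g‖ := by
    intro g b
    simp only [Matrix.mulVecLin_apply, Matrix.mulVec_diagonal]
    have h1 : ‖X.mulVec g‖ ≤ RX * ‖g‖ := norm_mulVec_le X hRX hX g
    have h2 : ‖Hs.mulVec (X.mulVec g)‖ ≤ cH * SH * ‖X.mulVec g‖ :=
      norm_mulVec_le Hs (mul_nonneg hcH hSH0) (rowsum_le_of_decay hcH hHs hSH) _
    have h3 : |Cl.mulVec (Hs.mulVec (X.mulVec g)) b| ≤ cC * SC * ‖Hs.mulVec (X.mulVec g)‖ :=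
      abs_mulVec_le Cl (rowsum_le_of_decay hcC hCl hSC) _ b
    calc |χ₄ b * Cl.mulVec (Hs.mulVec (X.mulVec g)) b| ≤ 1 * |Cl.mulVec (Hs.mulVec (X.mulVec g)) b| := by
          rw [abs_mul]; exact mul_le_mul_of_nonneg_right (hχ b) (abs_nonneg _)
      _ ≤ cC * SC * (cH * SH * (RX * ‖g‖)) := by
          rw [one_mul]
          refine h3.trans (mul_le_mul_of_nonneg_left (h2.trans ?_) (mul_nonneg hcC hSC0))
          exact mul_le_mul_of_nonneg_left h1 (mul_nonneg hcH hSH0)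
      _ = cC * SC * (cH * SH) * RX * ‖g‖ := by ring
  exact ineq594 L _ _ _ _ A' f inRegion (mul_nonneg (mul_nonneg (mul_nonneg hcC hSC0) (mul_nonneg hcH hSH0)) hRX) hA' hf hK

end Kernels

end Literature.MathematicalPhysics.QuantumFieldTheory.BalabanImbrieJaffe1984to88.BIJ88Ineq594Proof
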